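import Summits.AtomisticToContinuum.FouriersLaw.Theorems.BondHeatUncertaintySubdiffusiveBondHeatOfDeficitCesaroEW
import Summits.AtomisticToContinuum.FouriersLaw.Theorems.BondHeatUncertaintySubdiffusiveBondHeatTransientFormula
import Summits.AtomisticToContinuum.FouriersLaw.Theorems.BondHeatUncertaintyLightConeBondHeatGreenKuboDip

/-!
# The escape deficit is nonnegative; the Edwards–Wilkinson transient is NECESSARY for the stub

Crux `stmt-AtomisticToContinuum-9120` (`BondHeatUncertainty.SubdiffusiveBondHeat`, (S)), line `bath-bond-deficit-integral`.
Notation (VERBATIM the `let K / θ / E` of route `BoundaryEscapeDeficit`): `K_N(u) = ∫ (p₀² − T)·P_u(p₀² − T) dμ_T^N`,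
`θ_N(s) = (γ/T²)∫₀ˢ K_N`, `E_N = 1 − (γ/T²)∫_{(0,∞)} K_N` (the ESCAPE DEFICIT; `(N−1)γE_N = D_N` is the response
coefficient by `BoundaryEscapeDeficit.ResponseIdentity`, stmt-12237, open), `W_N(t) = ∫₀ᵗ (1 − θ_N)`.

* `pinnedChain_abs_transientIntegral_le_fixedN` — at fixed `N ≥ 1` the once-integrated transient is bounded on both
  sides, `|∫₀ᵗ (1 − θ_N − E_N)| ≤ B_N` for all `t ≥ 0` (two-sided form of the landed `pinnedChain_transientIntegral_le_fixedN`,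
  from `|1 − θ_N(s) − E_N| ≤ C'e^{−cs}`);
* `pinnedChain_escapeDeficit_nonneg` — **`0 ≤ E_N` for every `N ≥ 2`**, UNCONDITIONALLY (no linear response, no
  `ResponseIdentity`): the landed bath-bond reduction `0 ≤ V_N(0,t) ≤ 4γT² W_N(t) + 8E[e₀²]`
  (`stub_bathBondReduction_of_kernelFacts` + `LightConeBondHeat.pinnedChain_bondHeatVar_nonneg`) bounds `W_N` below uniformly
  in `t`, while `W_N(t) = tE_N + ∫₀ᵗ(transient)` with a bounded transient integral; so `tE_N` is bounded below for all
  `t ≥ 0`, forcing `E_N ≥ 0`.  Reading: the Green–Kubo contact conductance `γE_N` of the equilibrium chain is nonnegative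
  (`(γ/T²)∫₀^∞ K_N ≤ 1`: the integrated kinetic-temperature autocorrelation at the thermostatted site never exceeds
  `T²/γ = ∫₀^∞` of the free Ornstein–Uhlenbeck value `2T²e^{−2γu}`);  `escapeDeficit_nonneg` is the `∀`-form in the route's
  `dite` spelling;
* `transientCesaro_le_deficitCesaro` — hence `∫₀ᵗ (1 − θ_N − E_N) ≤ ∫₀ᵗ (1 − θ_N)` (`N ≥ 2`, `t ≥ 0`);
* `transientEW_of_deficitCesaroEW` — **the EW transient law (D1b) is NECESSARY for the registered stub**: the hypothesis
  of the landed transfer `subdiffusiveBondHeat_of_deficitCesaroEW` (= `stub_deficitCesaroEW`, the Cesàro EW law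
  `W_N(t) ≤ C√t` on `[1, cN²]`) implies the transient hypothesis of the landed glue
  `subdiffusiveBondHeat_of_ohmicFloor_transientEW` (`∫₀ᵗ(1 − θ_N − E_N) ≤ C√t` on the same window).  Together with that glue:
  `OhmicFloor ∧ TransientEW ⟹ DeficitCesaroEW-stub ⟹ TransientEW`, and (`Cruxes/…/Disproof.lean` §4, given a nonnegative
  transient) `⟹ OhmicFloor` — the crux-strategist's decomposition (S)|_{b=0} ≡ Ohm ⊕ EW-transient with one direction now
  kernel-checked.

Nothing here closes the item; every statement is fixed-`N` or a transfer between open `N`-uniform hypotheses.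
-/

noncomputable section

open MeasureTheory Set Filter Topology intervalIntegral
open scoped NNReal

namespace Summit.AtomisticToContinuum.FouriersLaw.Theorems.SubdiffusiveBondHeat

open Literature.MathematicalPhysics.KineticTheory.HeatConduction
open Summit.AtomisticToContinuum.FouriersLaw.Theorems.LightConeBondHeat (pinnedChain_bondHeatVar_nonneg)

section FixedN

variable {ω₂ lam β γ : ℝ} (hω : 0 < ω₂) (hl : 0 < lam) (hβ : 0 < β) (hγ : 0 < γ) {N : ℕ} (hN : 0 < N)
  {T : ℝ} (hT : 0 < T)
include hω hl hβ hγ hN hT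

/-- **Two-sided bound on the once-integrated transient at fixed `N`**: `|∫₀ᵗ (1 − θ_N(s) − E_N) ds| ≤ B` for all
`t ≥ 0` (from `|1 − θ_N(s) − E_N| ≤ C'e^{−cs}`, `pinnedChain_abs_transient_le`). [folklore] -/
theorem pinnedChain_abs_transientIntegral_le_fixedN :
    ∃ B : ℝ, ∀ t : ℝ, 0 ≤ t →
      |∫ s in (0 : ℝ)..t,
        (1 - γ / T ^ 2 * (∫ u in (0 : ℝ)..s,
            if h : 0 < N then
              ∫ z, ((z.2 ⟨0, h⟩) ^ 2 - T) *
                  (∫ y, ((y.2 ⟨0, h⟩) ^ 2 - T) ∂((pinnedChain ω₂ lam β γ).transitionKernel N T T u.toNNReal z))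
                ∂((pinnedChain ω₂ lam β γ).gibbsMeasure N T)
            else 0) -
          (1 - γ / T ^ 2 * (∫ u in Set.Ioi (0 : ℝ),
            if h : 0 < N then
              ∫ z, ((z.2 ⟨0, h⟩) ^ 2 - T) *
                  (∫ y, ((y.2 ⟨0, h⟩) ^ 2 - T) ∂((pinnedChain ω₂ lam β γ).transitionKernel N T T u.toNNReal z))
                ∂((pinnedChain ω₂ lam β γ).gibbsMeasure N T)
            else 0)))| ≤ B := by
  obtain ⟨C, c, hC0, hc, hdec⟩ := pinnedChain_abs_transient_le hω hl hβ hγ hN hT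
  refine ⟨C / c, fun t ht => ?_⟩
  have hcongr : ∫ s in (0 : ℝ)..t,
      (1 - γ / T ^ 2 * (∫ u in (0 : ℝ)..s,
          if h : 0 < N then
            ∫ z, ((z.2 ⟨0, h⟩) ^ 2 - T) *
                (∫ y, ((y.2 ⟨0, h⟩) ^ 2 - T) ∂((pinnedChain ω₂ lam β γ).transitionKernel N T T u.toNNReal z))
              ∂((pinnedChain ω₂ lam β γ).gibbsMeasure N T)
          else 0) -
        (1 - γ / T ^ 2 * (∫ u in Set.Ioi (0 : ℝ),
          if h : 0 < N then
            ∫ z, ((z.2 ⟨0, h⟩) ^ 2 - T) *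
                (∫ y, ((y.2 ⟨0, h⟩) ^ 2 - T) ∂((pinnedChain ω₂ lam β γ).transitionKernel N T T u.toNNReal z))
              ∂((pinnedChain ω₂ lam β γ).gibbsMeasure N T)
          else 0))) =
      ∫ s in (0 : ℝ)..t, γ / T ^ 2 * ∫ u in Set.Ioi s,
        ∫ z, ((z.2 ⟨0, hN⟩) ^ 2 - T) *
            (∫ y, ((y.2 ⟨0, hN⟩) ^ 2 - T) ∂((pinnedChain ω₂ lam β γ).transitionKernel N T T u.toNNReal z))
          ∂((pinnedChain ω₂ lam β γ).gibbsMeasure N T) := by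
    refine intervalIntegral.integral_congr fun s hs => ?_
    rw [uIcc_of_le ht] at hs
    exact pinnedChain_deficit_transient_eq hω hl hβ hγ hN hT s hs.1
  rw [hcongr, intervalIntegral.integral_of_le ht]
  set f : ℝ → ℝ := fun s => γ / T ^ 2 * ∫ u in Set.Ioi s,
      ∫ z, ((z.2 ⟨0, hN⟩) ^ 2 - T) *
          (∫ y, ((y.2 ⟨0, hN⟩) ^ 2 - T) ∂((pinnedChain ω₂ lam β γ).transitionKernel N T T u.toNNReal z))
        ∂((pinnedChain ω₂ lam β γ).gibbsMeasure N T) with hf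
  have hb : ∀ᵐ s ∂(volume.restrict (Ioc 0 t)), ‖f s‖ ≤ C * Real.exp (-c * s) :=
    (ae_restrict_iff' measurableSet_Ioc).2 (Eventually.of_forall fun s hs => by
      rw [Real.norm_eq_abs]; exact hdec s hs.1.le)
  have hIoi : IntegrableOn (fun s => C * Real.exp (-c * s)) (Ioi 0) := (exp_neg_integrableOn_Ioi 0 hc).const_mul C
  have h1 := norm_integral_le_of_norm_le (hIoi.mono_set Ioc_subset_Ioi_self) hb
  have h2 : ∫ s in Ioc 0 t, C * Real.exp (-c * s) ≤ ∫ s in Ioi 0, C * Real.exp (-c * s) :=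
    setIntegral_mono_set hIoi (Eventually.of_forall fun s => by positivity) (Eventually.of_forall Ioc_subset_Ioi_self)
  have h3 : ∫ s in Ioi 0, C * Real.exp (-c * s) = C / c := by
    rw [MeasureTheory.integral_const_mul, integral_exp_mul_Ioi (by linarith) 0]
    simp only [mul_zero, Real.exp_zero]
    field_simp
  rw [← Real.norm_eq_abs]
  exact h1.trans (h2.trans h3.le)

end FixedN

section Nonneg

variable {ω₂ lam β γ : ℝ} (hω : 0 < ω₂) (hl : 0 < lam) (hβ : 0 < β) (hγ : 0 < γ) {N : ℕ} (hN : 1 < N)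
  {T : ℝ} (hT : 0 < T)
include hω hl hβ hγ hN hT

/-- **The escape deficit is nonnegative**: `0 ≤ E_N = 1 − (γ/T²)∫_{(0,∞)} K_N` for every `N ≥ 2` — equivalently
`(γ/T²)∫₀^∞ K_N ≤ 1`, i.e. the Green–Kubo contact conductance `γE_N` of the equilibrium chain is `≥ 0`.  Proof: for all
`t ≥ 0`, `0 ≤ V_N(0,t) ≤ 4γT² W_N(t) + 8E[e₀²]` (landed bath-bond reduction + `V ≥ 0`) and `W_N(t) = tE_N + ∫₀ᵗ(transient)`
with `|∫₀ᵗ(transient)| ≤ B_N`; so `tE_N ≥ −2E[e₀²]/(γT²) − B_N` for every `t ≥ 0`, whence `E_N ≥ 0`. [folklore] -/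
theorem pinnedChain_escapeDeficit_nonneg :
    0 ≤ 1 - γ / T ^ 2 * (∫ u in Set.Ioi (0 : ℝ),
      if h : 0 < N then
        ∫ z, ((z.2 ⟨0, h⟩) ^ 2 - T) *
            (∫ y, ((y.2 ⟨0, h⟩) ^ 2 - T) ∂((pinnedChain ω₂ lam β γ).transitionKernel N T T u.toNNReal z))
          ∂((pinnedChain ω₂ lam β γ).gibbsMeasure N T)
      else 0) := by
  have hN0 : 0 < N := Nat.zero_lt_of_lt hN
  simp only [dif_pos hN0]
  -- the objects
  set K : ℝ → ℝ := fun u => ∫ z, ((z.2 ⟨0, hN0⟩) ^ 2 - T) *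
      (∫ y, ((y.2 ⟨0, hN0⟩) ^ 2 - T) ∂((pinnedChain ω₂ lam β γ).transitionKernel N T T u.toNNReal z))
    ∂((pinnedChain ω₂ lam β γ).gibbsMeasure N T) with hK
  set E : ℝ := 1 - γ / T ^ 2 * ∫ u in Set.Ioi (0 : ℝ), K u with hE
  set g : ℝ → ℝ := fun s => 1 - γ / T ^ 2 * ∫ u in (0 : ℝ)..s, K u with hg
  -- continuity of the deficit curve (interval integrability)
  have hgc : Continuous g := continuous_const.sub (pinnedChain_continuous_stepResponse hω hl hβ hγ hT hN0)
  -- the two-sided transient bound, despelled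
  obtain ⟨B, hB⟩ := pinnedChain_abs_transientIntegral_le_fixedN hω hl hβ hγ hN0 hT
  simp only [dif_pos hN0] at hB
  -- statics and the reduction
  obtain ⟨σ2, hσ⟩ := localEnergyMoment ω₂ lam β γ hω hl hβ hγ T hT
  have hred := stub_bathBondReduction_of_kernelFacts ω₂ lam β γ hω hl hβ hγ T hT N hN
    (stub_kernelDetailedBalance ω₂ lam β γ hω hl hβ hγ T hT N hN)
    (stub_siteEnergyDynkin ω₂ lam β γ hω hl hβ hγ T hT N hN)
    (stub_siteEnergyCurrentCovariance ω₂ lam β γ hω hl hβ hγ T hT N hN)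
  have hmom := hσ N hN
  have hγT2 : 0 < γ * T ^ 2 := by positivity
  -- lower bound on `t * E`, uniformly in `t ≥ 0`
  have hlow : ∀ t : ℝ, 0 ≤ t → -(2 * σ2) / (γ * T ^ 2) - B ≤ t * E := by
    intro t ht
    have hV0 := pinnedChain_bondHeatVar_nonneg hω hl.le hβ hγ hN0 hT ⟨0, hN0⟩ ht
    have hVle := hred t ht
    -- `W(t) = ∫ (g - E) + t E`
    have hgi : IntervalIntegrable g volume 0 t := hgc.intervalIntegrable 0 t
    have hsplit : ∫ s in (0 : ℝ)..t, g s = (∫ s in (0 : ℝ)..t, (g s - E)) + t * E := by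
      rw [intervalIntegral.integral_sub hgi intervalIntegrable_const, intervalIntegral.integral_const, sub_zero,
        smul_eq_mul]
      ring
    have hTr : (∫ s in (0 : ℝ)..t, (g s - E)) ≤ B := (le_abs_self _).trans (hB t ht)
    -- `0 ≤ V ≤ 4γT² W + 8 E[e₀²]`, `E[e₀²] ≤ σ2`
    have hW : 0 ≤ 4 * γ * T ^ 2 * (∫ s in (0 : ℝ)..t, g s) + 8 * σ2 := by
      have := hV0.trans hVle
      simp only [hg, hK] at this ⊢
      linarith
    rw [hsplit] at hW
    -- divide by `γT²`
    have h1 : -(2 * σ2) / (γ * T ^ 2) ≤ (∫ s in (0 : ℝ)..t, (g s - E)) + t * E := by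
      rw [div_le_iff₀ hγT2]
      nlinarith
    linarith
  -- conclude `E ≥ 0`
  by_contra hneg
  have hlt : E < 0 := not_le.mp hneg
  set A : ℝ := -(2 * σ2) / (γ * T ^ 2) - B with hA
  have hE0 : 0 < -E := by linarith
  -- take `t = (|A| + 1)/(-E)`
  have ht0 : 0 ≤ (|A| + 1) / (-E) := by positivity
  have key := hlow _ ht0
  have hEne : E ≠ 0 := hlt.ne
  have hmul : (|A| + 1) / (-E) * E = -(|A| + 1) := by
    have : (|A| + 1) / (-E) * E = -((|A| + 1) * (E / E)) := by ring
    rw [this, div_self hEne, mul_one]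
  rw [hmul] at key
  have hAabs : -A ≤ |A| := neg_le_abs A
  linarith

/-- **The once-integrated transient never exceeds the Cesàro deficit** (`N ≥ 2`, `t ≥ 0`):
`∫₀ᵗ (1 − θ_N(s) − E_N) ds ≤ ∫₀ᵗ (1 − θ_N(s)) ds`, since `E_N ≥ 0`. [folklore] -/
theorem transientCesaro_le_deficitCesaro {t : ℝ} (ht : 0 ≤ t) :
    (∫ s in (0 : ℝ)..t,
        (1 - γ / T ^ 2 * (∫ u in (0 : ℝ)..s,
            if h : 0 < N then
              ∫ z, ((z.2 ⟨0, h⟩) ^ 2 - T) *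
                  (∫ y, ((y.2 ⟨0, h⟩) ^ 2 - T) ∂((pinnedChain ω₂ lam β γ).transitionKernel N T T u.toNNReal z))
                ∂((pinnedChain ω₂ lam β γ).gibbsMeasure N T)
            else 0) -
          (1 - γ / T ^ 2 * (∫ u in Set.Ioi (0 : ℝ),
            if h : 0 < N then
              ∫ z, ((z.2 ⟨0, h⟩) ^ 2 - T) *
                  (∫ y, ((y.2 ⟨0, h⟩) ^ 2 - T) ∂((pinnedChain ω₂ lam β γ).transitionKernel N T T u.toNNReal z))
                ∂((pinnedChain ω₂ lam β γ).gibbsMeasure N T)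
            else 0)))) ≤
      ∫ s in (0 : ℝ)..t,
        (1 - γ / T ^ 2 * (∫ u in (0 : ℝ)..s,
            if h : 0 < N then
              ∫ z, ((z.2 ⟨0, h⟩) ^ 2 - T) *
                  (∫ y, ((y.2 ⟨0, h⟩) ^ 2 - T) ∂((pinnedChain ω₂ lam β γ).transitionKernel N T T u.toNNReal z))
                ∂((pinnedChain ω₂ lam β γ).gibbsMeasure N T)
            else 0)) := by
  have hN0 : 0 < N := Nat.zero_lt_of_lt hN
  have hE := pinnedChain_escapeDeficit_nonneg hω hl hβ hγ hN hT
  simp only [dif_pos hN0] at hE ⊢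
  have hgc : Continuous fun s : ℝ => 1 - γ / T ^ 2 * ∫ u in (0 : ℝ)..s,
      ∫ z, ((z.2 ⟨0, hN0⟩) ^ 2 - T) *
          (∫ y, ((y.2 ⟨0, hN0⟩) ^ 2 - T) ∂((pinnedChain ω₂ lam β γ).transitionKernel N T T u.toNNReal z))
        ∂((pinnedChain ω₂ lam β γ).gibbsMeasure N T) :=
    continuous_const.sub (pinnedChain_continuous_stepResponse hω hl hβ hγ hT hN0)
  have hgi : IntervalIntegrable _ volume 0 t := hgc.intervalIntegrable 0 t
  rw [intervalIntegral.integral_sub hgi intervalIntegrable_const, intervalIntegral.integral_const, sub_zero, smul_eq_mul]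
  nlinarith

end Nonneg

/-- **`0 ≤ E_N` for `N ≥ 2`, in the route's spelling** (`E_N` VERBATIM the `let E` of `BoundaryEscapeDeficit`, `dite`
included): the escape deficit / Green–Kubo contact conductance of the equilibrium pinned anharmonic chain is nonnegative,
unconditionally. [folklore] -/
theorem escapeDeficit_nonneg :
    ∀ ω₂ lam β γ : ℝ, 0 < ω₂ → 0 < lam → 0 < β → 0 < γ → ∀ T : ℝ, 0 < T → ∀ N : ℕ, 2 ≤ N →
      0 ≤ 1 - γ / T ^ 2 * (∫ u in Set.Ioi (0 : ℝ),
        if h : 0 < N then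
          ∫ z, ((z.2 ⟨0, h⟩) ^ 2 - T) *
              (∫ y, ((y.2 ⟨0, h⟩) ^ 2 - T) ∂((pinnedChain ω₂ lam β γ).transitionKernel N T T u.toNNReal z))
            ∂((pinnedChain ω₂ lam β γ).gibbsMeasure N T)
        else 0) := by
  intro ω₂ lam β γ hω hl hβ hγ T hT N hN
  exact pinnedChain_escapeDeficit_nonneg hω hl hβ hγ (lt_of_lt_of_le one_lt_two hN) hT

/-- **The Edwards–Wilkinson transient law is NECESSARY for the stub.**  The hypothesis of the landed transfer
`subdiffusiveBondHeat_of_deficitCesaroEW` (= the registered open stub `stub_deficitCesaroEW`: `∫₀ᵗ(1 − θ_N) ≤ C√t` on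
`[1, cN²]`, `N ≥ N₀`) implies the transient hypothesis of the landed glue `subdiffusiveBondHeat_of_ohmicFloor_transientEW`
(`∫₀ᵗ(1 − θ_N − E_N) ≤ C√t` on the same window, `N ≥ max N₀ 2`), because `E_N ≥ 0`. [folklore] -/
theorem transientEW_of_deficitCesaroEW :
    (∀ ω₂ lam β γ : ℝ, 0 < ω₂ → 0 < lam → 0 < β → 0 < γ → ∀ T : ℝ, 0 < T →
      ∃ C c : ℝ, 0 < c ∧ ∃ N₀ : ℕ, ∀ N : ℕ, N₀ ≤ N → ∀ t : ℝ, 1 ≤ t → t ≤ c * (N : ℝ) ^ 2 →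
        (∫ s in (0 : ℝ)..t,
          (1 - γ / T ^ 2 * (∫ u in (0 : ℝ)..s,
            if h : 0 < N then
              ∫ z, ((z.2 ⟨0, h⟩) ^ 2 - T) *
                  (∫ y, ((y.2 ⟨0, h⟩) ^ 2 - T)
                    ∂((pinnedChain ω₂ lam β γ).transitionKernel N T T u.toNNReal z))
                ∂((pinnedChain ω₂ lam β γ).gibbsMeasure N T)
            else 0))) ≤ C * Real.sqrt t) →
    (∀ ω₂ lam β γ : ℝ, 0 < ω₂ → 0 < lam → 0 < β → 0 < γ → ∀ T : ℝ, 0 < T →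
      ∃ C₂ c : ℝ, 0 < c ∧ ∃ N₀ : ℕ, ∀ N : ℕ, N₀ ≤ N → ∀ t : ℝ, 1 ≤ t → t ≤ c * (N : ℝ) ^ 2 →
        (∫ s in (0 : ℝ)..t,
          (1 - γ / T ^ 2 * (∫ u in (0 : ℝ)..s,
              if h : 0 < N then
                ∫ z, ((z.2 ⟨0, h⟩) ^ 2 - T) *
                    (∫ y, ((y.2 ⟨0, h⟩) ^ 2 - T)
                      ∂((pinnedChain ω₂ lam β γ).transitionKernel N T T u.toNNReal z))
                  ∂((pinnedChain ω₂ lam β γ).gibbsMeasure N T)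
              else 0) -
            (1 - γ / T ^ 2 * (∫ u in Set.Ioi (0 : ℝ),
              if h : 0 < N then
                ∫ z, ((z.2 ⟨0, h⟩) ^ 2 - T) *
                    (∫ y, ((y.2 ⟨0, h⟩) ^ 2 - T)
                      ∂((pinnedChain ω₂ lam β γ).transitionKernel N T T u.toNNReal z))
                  ∂((pinnedChain ω₂ lam β γ).gibbsMeasure N T)
              else 0)))) ≤ C₂ * Real.sqrt t) := by
  intro h ω₂ lam β γ hω hl hβ hγ T hT
  obtain ⟨C, c, hc, N₀, hC⟩ := h ω₂ lam β γ hω hl hβ hγ T hT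
  refine ⟨C, c, hc, max N₀ 2, fun N hN t ht htc => ?_⟩
  have hN₀ : N₀ ≤ N := le_trans (le_max_left _ _) hN
  have hN2 : 1 < N := lt_of_lt_of_le one_lt_two (le_trans (le_max_right _ _) hN)
  have ht0 : 0 ≤ t := le_trans zero_le_one ht
  exact (transientCesaro_le_deficitCesaro hω hl hβ hγ hN2 hT ht0).trans (hC N hN₀ t ht htc)

end Summit.AtomisticToContinuum.FouriersLaw.Theorems.SubdiffusiveBondHeat

end
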